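import Mathlib
import Literature.MathematicalPhysics.QuantumManyBody.PeriodicBoseGasFracEnergy
import Literature.MathematicalPhysics.QuantumManyBody.TorusAutocorrelationKernel
import Literature.MathematicalPhysics.QuantumManyBody.PeriodicCondensateCoherence
import Literature.MathematicalPhysics.QuantumManyBody.InsertionStateIdentities
import Summits.AtomisticToContinuum.BoseEinsteinCondensation.Theorems.BECThomsonPrincipleGDTransferLnssAlgebraOps
import HarnessLib

/-!
# The translation coherence of a periodic state through the plane-wave occupations

Helper for item stmt-AtomisticToContinuum-9002 (`BallCriterion`, route BECSubharmonicContinuation):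
for a periodic trial state `Ψ` of `n+1` bosons on the torus of side `L`, a particle `i` and
`y ∈ ℝ³`, the translated pairing
`∫_{cell^{n+1}} conj Ψ(X with xᵢ ↦ xᵢ + y) Ψ(X) dX = (n+1)⁻¹ ∑_{p ∈ ℤ³} n_p conj(e_p(y))`,
`n_p = ⟨φ_p, γ_Ψ φ_p⟩` the occupation of the normalised plane wave `φ_p = L^{-3/2} e_p`
(`cellOccupation … (planeWaveMode L p)`), an absolutely convergent sum (`∑_p n_p = n+1`).
Proof: Bose symmetry moves `i` to the first slot, Fubini splits `X = (x, Y)`, the polarised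
Parseval identity on the 3-torus with the translation rule `ĉ_p(f(· + y)) = e_p(y) ĉ_p(f)` gives
`∫_cell conj f(x+y) f(x) dx = L³ ∑_p conj(e_p(y)) |ĉ_p(f)|²` for each slice `f = Ψ(·, Y)`, and the
sum is exchanged with the `Y`-integral (`integral_tsum`, the occupations being summable).
-/

noncomputable section

open MeasureTheory Filter Set WithLp Complex Metric UnitAddTorus
open scoped ENNReal NNReal ComplexConjugate

namespace Summit.AtomisticToContinuum.BoseEinsteinCondensation.Theorems

open Literature.MathematicalPhysics.QuantumManyBody.BoseGas

section Slices

variable {n : ℕ} {L : ℝ}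

/-- **The translated pairing through slices at the first particle**: for a periodic trial state
of `n+1` bosons, `∫_{cell^{n+1}} conj Ψ(X with xᵢ ↦ xᵢ + y) Ψ(X) dX =
∫_{cell^n} ∫_cell conj Ψ(x + y, Y) Ψ(x, Y) dx dY` (Bose symmetry, then Fubini). [folklore] -/
theorem setIntegral_conj_translate_mul_eq_slice (Ψ : PeriodicTrialState (n + 1) L)
    (i : Fin (n + 1)) (y : Space) :
    ∫ X in cellN (n + 1) L, conj (Ψ.ψ (Function.update X i (X i + y))) * Ψ.ψ X =
      ∫ Y in cellN n L, ∫ x in cell L,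
        conj (Ψ.ψ (Matrix.vecCons (x + y) Y)) * Ψ.ψ (Matrix.vecCons x Y) := by
  set F : Config (n + 1) → ℂ := fun X => conj (Ψ.ψ (Function.update X 0 (X 0 + y))) * Ψ.ψ X
    with hF
  have hFc : Continuous F := by
    have hc := Ψ.contDiff.continuous
    refine (Complex.continuous_conj.comp (hc.comp ?_)).mul hc
    exact continuous_id.update 0 ((continuous_apply 0).add continuous_const)
  -- Bose symmetry: slot `i` to slot `0`
  have hsym : ∀ X : Config (n + 1),
      conj (Ψ.ψ (Function.update X i (X i + y))) * Ψ.ψ X = F (X ∘ Equiv.swap 0 i) := by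
    intro X
    simp only [hF, Function.comp_apply, Equiv.swap_apply_left]
    rw [← update_comp_swap X i (X i + y), Ψ.symm, Ψ.symm]
  simp_rw [hsym]
  rw [Cruxes.GDTransfer.DysonDressedWitness.Lnss.setIntegral_cellN_comp_perm (Equiv.swap 0 i) F,
    setIntegral_cellN_succ_right_of_continuous hFc]
  refine integral_congr_ae (Eventually.of_forall fun Y => ?_)
  refine integral_congr_ae (Eventually.of_forall fun x => ?_)
  simp only [hF, Matrix.cons_val_zero]
  rw [show Function.update (Matrix.vecCons x Y) 0 (x + y) = Matrix.vecCons (x + y) Y from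
    Fin.update_cons_zero (α := fun _ => Space) x Y (x + y)]

end Slices

section OneBody

variable {L : ℝ}

/-- **Polarised Parseval with a translate, on the cell**: for a continuous `Lℤ³`-periodic `f` and
`y ∈ ℝ³`, `∫_{[0,L)³} conj f(x + y) f(x) dx = L³ ∑_{p ∈ ℤ³} conj(e_p(y)) |ĉ_p(f)|²` (transport to
`(ℝ/ℤ)³`, the translation rule `ĉ_p(f(· + y)) = e_p(y) ĉ_p(f)`, Parseval). [folklore] -/
theorem hasSum_setIntegral_conj_translate_mul (hL : 0 < L) {f : Space → ℂ} (hf : Continuous f)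
    (hper : ∀ (x : Space) (k : Fin 3), f (x + EuclideanSpace.single k L) = f x) (y : Space) :
    HasSum (fun p : Fin 3 → ℤ => ((L ^ 3 : ℝ) : ℂ) *
        (conj (cellWave L p y) * ((‖cellFourierCoeff L f p‖ ^ 2 : ℝ) : ℂ)))
      (∫ x in cell L, conj (f (x + y)) * f x) := by
  -- the measure on `ℝ/ℤ` is the Haar probability measure (the convention of
  -- `PeriodicBoseGasFourier.lean` / `PeriodicConfigFourier.lean`, under which the transport lemmas
  -- and the Fourier coefficients are stated)
  letI : MeasureSpace UnitAddCircle := configFourier_measureSpace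
  set F : UnitAddTorus (Fin 3) → ℂ := torusFun L f with hFdef
  have hF2 : MemLp F 2 volume := memLp_torusFun hL hf
  set s : UnitAddTorus (Fin 3) := toUnitTorus L y with hs
  set Φ : UnitAddTorus (Fin 3) → ℂ := torusFun L (fun x => f (x + y)) with hΦdef
  have hΦ2 : MemLp Φ 2 volume := memLp_torusFun hL (hf.comp (continuous_id.add continuous_const))
  have hΦF : ∀ t, Φ t = F (t + s) := by
    intro t
    simp only [hΦdef, hFdef, torusFun, hs]
    obtain ⟨m, hm⟩ := exists_fromUnitTorus_add_toUnitTorus hL t y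
    rw [hm, periodic_latticeVec hper]
  have hP := hasSum_conj_mFourierCoeff_mul hΦ2 hF2
  have hcoef : ∀ p, mFourierCoeff Φ p = cellWave L p y * cellFourierCoeff L f p := by
    intro p
    rw [show Φ = fun t => F (t + s) from funext hΦF, mFourierCoeff_comp_add_right]
    rfl
  have hterm : ∀ p, conj (mFourierCoeff Φ p) * mFourierCoeff F p =
      conj (cellWave L p y) * ((‖cellFourierCoeff L f p‖ ^ 2 : ℝ) : ℂ) := by
    intro p
    rw [hcoef, map_mul, mul_assoc]
    congr 1
    change conj (cellFourierCoeff L f p) * cellFourierCoeff L f p = _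
    rw [Complex.conj_mul']
    push_cast
    rfl
  simp only [hterm] at hP
  have hint : ∫ t, conj (Φ t) * F t = ((L ^ 3)⁻¹ : ℝ) • ∫ x in cell L, conj (f (x + y)) * f x := by
    have h := integral_fromUnitTorus hL (fun x => conj (f (x + y)) * f x)
    rw [← h]
    rfl
  rw [hint] at hP
  have hL3 : (L : ℂ) ^ 3 ≠ 0 := pow_ne_zero 3 (Complex.ofReal_ne_zero.2 hL.ne')
  have h2 := hP.mul_left ((L : ℂ) ^ 3)
  rw [Complex.real_smul, ← mul_assoc] at h2
  push_cast at h2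
  rw [mul_inv_cancel₀ hL3, one_mul] at h2
  push_cast
  exact h2

end OneBody

section Occupations

variable {n : ℕ} {L : ℝ}

/-- The slice Fourier coefficients `Y ↦ ĉ_p(Ψ(·, Y))` are strongly measurable. [folklore] -/
theorem stronglyMeasurable_cellFourierCoeff_slice (hL : 0 < L) {Ψ : Config (n + 1) → ℂ}
    (hΨ : Continuous Ψ) (p : Fin 3 → ℤ) :
    StronglyMeasurable fun Y : Config n =>
      cellFourierCoeff L (fun x => Ψ (Matrix.vecCons x Y)) p := by
  have h : StronglyMeasurable
      (Function.uncurry fun (Y : Config n) (x : Space) =>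
        conj (cellWave L p x) * Ψ (Matrix.vecCons x Y)) := by
    refine Continuous.stronglyMeasurable ?_
    exact (Complex.continuous_conj.comp ((contDiff_cellWave L p).continuous.comp continuous_snd)).mul
      (hΨ.comp (continuous_snd.matrixVecCons continuous_fst))
  have h2 := h.integral_prod_right' (ν := volume.restrict (cell L))
  simp only [cellFourierCoeff_eq_integral hL]
  exact h2.const_smul ((L ^ 3)⁻¹ : ℝ)

/-- **Plane-wave occupations through the slice Fourier coefficients**:
`⟨φ_p, γ_Ψ φ_p⟩ = (n+1) L³ ∫_{cell^n} |ĉ_p(Ψ(·,Y))|² dY`. [folklore] -/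
theorem cellOccupation_planeWaveMode_eq_lintegral (hL : 0 < L) (p : Fin 3 → ℤ)
    (Ψ : Config (n + 1) → ℂ) :
    cellOccupation (n + 1) L (planeWaveMode L p) Ψ = (n + 1 : ℝ≥0∞) * (ENNReal.ofReal L ^ 3 *
      ∫⁻ Y in cellN n L,
        (‖cellFourierCoeff L (fun x => Ψ (Matrix.vecCons x Y)) p‖₊ : ℝ≥0∞) ^ 2) := by
  rw [cellOccupation_succ]
  simp only [nnnorm_sq_integral_conj_planeWaveMode_mul hL]
  rw [lintegral_const_mul' _ _ (ENNReal.pow_ne_top ENNReal.ofReal_ne_top)]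

/-- The slice Parseval masses are summable: `∑_p ∫_{cell^n} |ĉ_p(Ψ(·,Y))|² dY = L⁻³` for a
periodic trial state (`∑_p n_p = n+1`). [folklore] -/
theorem tsum_lintegral_cellFourierCoeff_slice (hL : 0 < L) (Ψ : PeriodicTrialState (n + 1) L) :
    ∑' p : Fin 3 → ℤ, ∫⁻ Y in cellN n L,
        (‖cellFourierCoeff L (fun x => Ψ.ψ (Matrix.vecCons x Y)) p‖₊ : ℝ≥0∞) ^ 2 =
      (ENNReal.ofReal L ^ 3)⁻¹ := by
  have hL3 : ENNReal.ofReal L ^ 3 ≠ 0 := pow_ne_zero _ (by simpa using hL)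
  have hL3' : ENNReal.ofReal L ^ 3 ≠ ⊤ := ENNReal.pow_ne_top ENNReal.ofReal_ne_top
  have hN : ((n : ℝ≥0∞) + 1) ≠ 0 := by simp
  have hN' : ((n : ℝ≥0∞) + 1) ≠ ⊤ := by simp
  have h := Ψ.tsum_cellOccupation_planeWaveMode hL
  simp only [cellOccupation_planeWaveMode_eq_lintegral hL] at h
  rw [ENNReal.tsum_mul_left, ENNReal.tsum_mul_left] at h
  push_cast at h
  -- `(n+1) (L³ S) = n+1`
  have h2 : ENNReal.ofReal L ^ 3 * ∑' p : Fin 3 → ℤ, ∫⁻ Y in cellN n L,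
      (‖cellFourierCoeff L (fun x => Ψ.ψ (Matrix.vecCons x Y)) p‖₊ : ℝ≥0∞) ^ 2 = 1 := by
    have := (ENNReal.mul_right_inj hN hN').1 (h.trans (mul_one _).symm)
    exact this
  calc ∑' p : Fin 3 → ℤ, ∫⁻ Y in cellN n L,
        (‖cellFourierCoeff L (fun x => Ψ.ψ (Matrix.vecCons x Y)) p‖₊ : ℝ≥0∞) ^ 2
      = (ENNReal.ofReal L ^ 3)⁻¹ * (ENNReal.ofReal L ^ 3 * ∑' p : Fin 3 → ℤ, ∫⁻ Y in cellN n L,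
          (‖cellFourierCoeff L (fun x => Ψ.ψ (Matrix.vecCons x Y)) p‖₊ : ℝ≥0∞) ^ 2) := by
        rw [← mul_assoc, ENNReal.inv_mul_cancel hL3 hL3', one_mul]
    _ = (ENNReal.ofReal L ^ 3)⁻¹ := by rw [h2, mul_one]

/-- The real slice Parseval mass of the mode `p` is `L⁻³ n_p/(n+1)`. [folklore] -/
theorem integral_sq_cellFourierCoeff_slice (hL : 0 < L) (Ψ : PeriodicTrialState (n + 1) L)
    (p : Fin 3 → ℤ) :
    ∫ Y in cellN n L, ‖cellFourierCoeff L (fun x => Ψ.ψ (Matrix.vecCons x Y)) p‖ ^ 2 =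
      (L ^ 3)⁻¹ * ((cellOccupation (n + 1) L (planeWaveMode L p) Ψ.ψ).toReal / (n + 1)) := by
  have hL3 : (0 : ℝ) < L ^ 3 := by positivity
  have hsm := stronglyMeasurable_cellFourierCoeff_slice hL Ψ.contDiff.continuous p (n := n)
  rw [integral_eq_lintegral_of_nonneg_ae (Eventually.of_forall fun Y => by positivity)
    (hsm.norm.measurable.pow_const 2).aestronglyMeasurable]
  simp only [← coe_nnnorm_sq_eq_ofReal]
  have hN : ((n : ℝ≥0∞) + 1).toReal = (n : ℝ) + 1 := by
    rw [ENNReal.toReal_add (ENNReal.natCast_ne_top n) ENNReal.one_ne_top, ENNReal.toReal_natCast,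
      ENNReal.toReal_one]
  rw [cellOccupation_planeWaveMode_eq_lintegral hL p Ψ.ψ, ENNReal.toReal_mul, ENNReal.toReal_mul,
    ENNReal.toReal_pow, ENNReal.toReal_ofReal hL.le, hN]
  field_simp

end Occupations

section Representation

variable {n : ℕ} {L : ℝ}

/-- **The translated pairing through the plane-wave occupations**: for a periodic trial state
`Ψ` of `n+1` bosons on the torus of side `L`, every particle `i` and `y ∈ ℝ³`,
`∫_{cell^{n+1}} conj Ψ(X with xᵢ ↦ xᵢ + y) Ψ(X) dX = ∑_p (n_p/(n+1)) conj(e_p(y))`,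
`n_p = ⟨φ_p, γ_Ψ φ_p⟩` the occupation of the normalised plane wave `φ_p`. [folklore] -/
theorem setIntegral_conj_translate_mul_eq_tsum (hL : 0 < L) (Ψ : PeriodicTrialState (n + 1) L)
    (i : Fin (n + 1)) (y : Space) :
    ∫ X in cellN (n + 1) L, conj (Ψ.ψ (Function.update X i (X i + y))) * Ψ.ψ X =
      ∑' p : Fin 3 → ℤ,
        (((cellOccupation (n + 1) L (planeWaveMode L p) Ψ.ψ).toReal / (n + 1) : ℝ) : ℂ) *
          conj (cellWave L p y) := by
  have hcont : Continuous Ψ.ψ := Ψ.contDiff.continuous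
  -- the slices at the first particle are continuous and periodic
  have hupd : ∀ (Y : Config n) (x : Space),
      Function.update (Matrix.vecCons (0 : Space) Y) 0 x = Matrix.vecCons x Y := fun Y x =>
    Fin.update_cons_zero (α := fun _ => Space) 0 Y x
  have hslc : ∀ Y : Config n, Continuous fun x => Ψ.ψ (Matrix.vecCons x Y) := fun Y =>
    hcont.comp (continuous_id.matrixVecCons continuous_const)
  have hper : ∀ (Y : Config n) (x : Space) (k : Fin 3),
      Ψ.ψ (Matrix.vecCons (x + EuclideanSpace.single k L) Y) = Ψ.ψ (Matrix.vecCons x Y) :=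
    fun Y x k => by simpa only [hupd] using Ψ.periodic_slice (Matrix.vecCons 0 Y) 0 x k
  rw [setIntegral_conj_translate_mul_eq_slice Ψ i y]
  -- each slice through Parseval
  set g : (Fin 3 → ℤ) → Config n → ℂ := fun p Y => ((L ^ 3 : ℝ) : ℂ) *
    (conj (cellWave L p y) *
      ((‖cellFourierCoeff L (fun x => Ψ.ψ (Matrix.vecCons x Y)) p‖ ^ 2 : ℝ) : ℂ)) with hg
  have hinner : ∀ Y : Config n, ∫ x in cell L,
      conj (Ψ.ψ (Matrix.vecCons (x + y) Y)) * Ψ.ψ (Matrix.vecCons x Y) = ∑' p, g p Y := fun Y =>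
    ((hasSum_setIntegral_conj_translate_mul hL (hslc Y) (hper Y) y).tsum_eq).symm
  simp_rw [hinner]
  -- exchange sum and integral
  have hmeas : ∀ p, AEStronglyMeasurable (g p) (volume.restrict (cellN n L)) := by
    intro p
    have hsm := stronglyMeasurable_cellFourierCoeff_slice hL hcont p (n := n)
    refine (StronglyMeasurable.const_mul ?_ _).aestronglyMeasurable
    refine StronglyMeasurable.const_mul ?_ _
    exact (Complex.continuous_ofReal.comp_stronglyMeasurable (hsm.norm.pow 2))
  have hnorm : ∀ p Y, ‖g p Y‖ₑ = ENNReal.ofReal L ^ 3 *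
      (‖cellFourierCoeff L (fun x => Ψ.ψ (Matrix.vecCons x Y)) p‖₊ : ℝ≥0∞) ^ 2 := by
    intro p Y
    rw [← ofReal_norm, hg]
    simp only [norm_mul, Complex.norm_conj, norm_cellWave, one_mul, Complex.norm_real,
      Real.norm_of_nonneg (pow_nonneg hL.le 3), Real.norm_of_nonneg (sq_nonneg _)]
    rw [ENNReal.ofReal_mul (pow_nonneg hL.le 3), ENNReal.ofReal_pow hL.le, coe_nnnorm_sq_eq_ofReal]
  have hL3 : ENNReal.ofReal L ^ 3 ≠ 0 := pow_ne_zero _ (by simpa using hL)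
  have hL3' : ENNReal.ofReal L ^ 3 ≠ ⊤ := ENNReal.pow_ne_top ENNReal.ofReal_ne_top
  have hsum : ∑' p, ∫⁻ Y in cellN n L, ‖g p Y‖ₑ ≠ ⊤ := by
    simp only [hnorm]
    simp_rw [lintegral_const_mul' _ _ hL3']
    rw [ENNReal.tsum_mul_left, tsum_lintegral_cellFourierCoeff_slice hL Ψ,
      ENNReal.mul_inv_cancel hL3 hL3']
    exact ENNReal.one_ne_top
  rw [integral_tsum hmeas hsum]
  refine tsum_congr fun p => ?_
  have hLc : (L : ℂ) ≠ 0 := Complex.ofReal_ne_zero.2 hL.ne'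
  rw [hg]
  simp only
  rw [integral_const_mul, integral_const_mul, integral_complex_ofReal,
    integral_sq_cellFourierCoeff_slice hL Ψ p]
  push_cast
  field_simp

end Representation

end Summit.AtomisticToContinuum.BoseEinsteinCondensation.Theorems

end
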